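import Summits.HodgeConjecture.Ring2.LowDimensionHodgeOfMarkmanRows
import Literature.AlgebraicGeometry.HodgeTheory.TimesLowGenericProductSpan
import HarnessLib

/-!
# Fivefolds with a simple fourfold isogeny factor: the residual cell modulo Markman shrinks to «CM elliptic curve × simple non-CM fourfold OF TYPE IV», granted HC on the simple non-CM fourfolds

Cell `pub-hodge-ring2` (HONEST FRAMING: research route conditional on HC_CM; not a corollary; Q11.4-sentence-2 already
refuted in dim ≥ 3), Literature lane (lit seat, generation 63, programme R35-D). Sequel of `Ring2/LowDimensionHodgeOfMarkman{,CM,Rows}`.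
Theorems only (no definition, no named fact, no `sorry`). Hypotheses, all explicit and none discharged: `hMark` (the tree's
named fact `Markman2025_weilClasses_algebraic_abelianFourfold`) and, where stated, the CLASS TARGET
`HC(simple fourfolds not of CM type)` — the residual cell of row `4` (`hcAtDim_four_iff_simple_nonCM_of_markman`), i.e.
Moonen–Zarhin 1995 + `hMark`, in print, not in the tree — taken as a hypothesis `hH1 : HCOnClass …`, never as a fact.

THE POINT. In R35-C the row-`5` residual contained «fivefolds with a simple fourfold isogeny factor `F` not of CM type».
Such an `X` is `∼ F × C` with `C` an elliptic curve (R35 §1), and the Hodge classes of `F × C` SPLIT in two printed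
situations, both THEOREMS of the tree: (i) `End⁰(C) = ℚ` — Moonen–Zarhin Lemma (3.4) with (2.4)/(3.1) for a generic factor
of dimension `≤ 3` (`hodgeClassesProductSpan_of_lowGeneric_of_forall_hom_eq_zero`, `Hom(F, C) = 0` by simplicity); (ii) `C`
of CM type and `F` WITHOUT factor of type IV — Thm. (3.2)(2) (`hodgeConjectureFor_prod_iff_of_hasNoTypeIVFactor_of_isOfCMType`).
So `HC(X) ⟸ HC(F)`, and the cell shrinks to «`X ∼ C × F`, `C` an elliptic curve OF CM TYPE, `F` a simple fourfold not of CM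
type and NOT free of type IV» — Moonen–Zarhin's case (g) («`k ↪ End⁰(X₂)` acting with multiplicities `(1,3)`», Thm. 0.2 (3):
`B• = D•`) together with its `(2,2)` sibling inside Thm. 0.2 (4); neither is a theorem of the tree.
* §1 `hodgeConjectureFor_prod_curve_of_finrank_eq_one_of_hodgeConjectureFor` (any `A` with `Hom(A, C) = 0`, `End⁰(C) = ℚ`),
  `hodgeConjectureFor_prod_cmCurve_of_hasNoTypeIVFactor_of_hodgeConjectureFor`, and for a simple fourfold `F`:
  **`hodgeConjectureFor_simple_prod_curve_of_hodgeConjectureFor`** (`F` simple, `dim F ≥ 2`: `HC(F × C) ⟸ HC(F)` unless `C` CM and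
  `F` has a type-IV factor).
* §2 `isOfCMType_curve_of_avDominatedBy_cmCurve` (for `X ∼ F × C`: a CM elliptic factor of `X` forces `C` CM),
  **`hodgeConjectureFor_of_avDominatedBy_simpleFourfold_of_hodgeConjectureFor`** — a fivefold with a simple fourfold factor `F`
  satisfying HC, outside the cell «CM elliptic factor and `F` with a type-IV factor», satisfies HC; with `hMark` and the class
  hypothesis `hH1`: **`hodgeConjectureFor_of_dim_eq_five_of_markman_of_simpleFourfolds`**.
* §3 the axis: **`hcAtDim_five_iff_of_markman_of_simpleFourfolds`** and **`hcUpToDim_five_iff_of_markman'`** —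
  `HCUpToDim 5 ↔ HC(simple non-CM fourfolds) ∧ HC(𝒞₅″)`, `𝒞₅″` = simple non-CM fivefolds ∪ «CM curve × simple non-CM fourfold
  with a type-IV factor» ∪ «`E² × T`, `dim_ℚ End⁰(T) = 2`»; `hcUpToDim_five_iff_of_markman_of_tankeevRibet'` (the simple
  fivefold cell closed by Tankeev–Ribet, a hypothesis); on path `refinedResidualCells_of_hodgeConjecture`.
NOT CLAIMED: any cell decided; `hMark`, `hH1` discharged; anything on `D² ≠ B²`.

## References
* [MoonenZarhin1999LowDim] B. Moonen, Yu. Zarhin, Math. Ann. 315 (1999) 711–733: case (g), Thm. 0.2 (3)–(4), §3 (3.1), Thm. (3.2)(2),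
  Lemma (3.4) [corpus: paper:arxiv-math_9901113 p0001, p0006–p0007]. [cite: MoonenZarhin1999LowDim, Thm. 0.2 (3)–(4) and §3 Lemma (3.4)]
* [MumfordAV1970] D. Mumford, *Abelian Varieties* (1970), §19 Thm. 1 and Cor. 1–2 (pp. 173–174). [cite: MumfordAV1970, §19 Thm. 1 (pp. 173–174)]
* [Lombardo2016] D. Lombardo, Ann. Inst. Fourier 66 (2016), Lemma 3.4 (p. 1229). [cite: Lombardo2016, Lemma 3.4 (p. 1229)]
* [VoisinHodgeII2003] C. Voisin, *Hodge Theory and Complex Algebraic Geometry II*, proof of Prop. 9.20 (exterior products of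
  algebraic classes). [cite: VoisinHodgeII2003, proof of Prop. 9.20 (first display)]
* [Markman2025SurveySecant] E. Markman, arXiv:2509.23403, Thm. 1.2 and Cor. 1.3. [claim: Markman2025SurveySecant, status: under-review]
* [Deligne2000] P. Deligne, *The Hodge conjecture* (Clay, 2000), §1. [cite: Deligne2000, §1]
-/

noncomputable section

open CategoryTheory CategoryTheory.Limits

namespace Summit.HodgeConjecture.Ring2.LowDimOfMarkman

open Literature.AlgebraicGeometry.Motives (AbelianVariety)
open Literature.AlgebraicGeometry.Motives.AbelianVariety
open Literature.AlgebraicGeometry.HodgeTheory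
open Literature.AlgebraicGeometry.ComplexMultiplication
open Literature.AlgebraicGeometry.Milne1999
open Summit.HodgeConjecture.CorCM (avDominatedBy_prod_right)
open Summit.HodgeConjecture.CorCM.Domination
open Summit.HodgeConjecture.Ring2.NonSimpleFourfolds (hom_eq_zero_of_isSimple_of_dim_lt)
open Summit.HodgeConjecture.CorCM.CMWeights (hodgeConjectureFor_of_isOfCMType_dim_le_five_of_markman)
open Summit.HodgeConjecture.Ring2.NonSimpleFivefolds (isOfCMType_of_avDominatedBy avDominatedBy_right_of_forall_hom_eq_zero)
open Summit.HodgeConjecture.HodgeConjecture.Ring2.ClassTargets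

variable {X A C F : AbelianVariety ℂ}

/-! ### §1 `HC(A × C) ⟸ HC(A)` for an elliptic curve `C`, in the two printed splitting situations -/

/-- **`HC(A × C) ⟸ HC(A)` for `C` an elliptic curve with `End⁰(C) = ℚ` and `Hom(A, C) = 0`** (Moonen–Zarhin Lemma (3.4) with
(2.4), (3.1): the Hodge classes of `A × C` are spanned by exterior products — the tree's
`hodgeClassesProductSpan_of_lowGeneric_of_forall_hom_eq_zero` —, exterior products of algebraic classes are algebraic, and
`HC(C)` is unconditional). [cite: MoonenZarhin1999LowDim, §3 (3.1) and Lemma (3.4)] [cite: VoisinHodgeII2003, proof of Prop. 9.20 (first display)] -/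
theorem hodgeConjectureFor_prod_curve_of_finrank_eq_one_of_hodgeConjectureFor (hC : C.dim = 1)
    (hCend : Module.finrank ℚ C.endAlgebra = 1) (hAC : ∀ u : A ⟶ C, u = 0) (hA : HodgeConjectureFor A.dim A.X) :
    HodgeConjectureFor (A.prod C).dim (A.prod C).X :=
  hodgeConjectureFor_prod_of_productSpan A C
    (hodgeClassesProductSpan_of_lowGeneric_of_forall_hom_eq_zero (by omega) (by omega) hCend hAC) hA
    (hodgeConjectureFor_of_dim_le_three_holds (by omega) isSmoothProjective_holds)

/-- **`HC(A × C) ⟸ HC(A)` for `C` an elliptic curve OF CM TYPE and `A` WITHOUT factor of type IV** (Thm. (3.2)(2), the tree's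
`hodgeConjectureFor_prod_iff_of_hasNoTypeIVFactor_of_isOfCMType`). [cite: MoonenZarhin1999LowDim, §3 Thm. (3.2)(2)]
[cite: Lombardo2016, Lemma 3.4 (p. 1229)] -/
theorem hodgeConjectureFor_prod_cmCurve_of_hasNoTypeIVFactor_of_hodgeConjectureFor (hC : C.dim = 1) (hCcm : IsOfCMType C)
    (hA4 : HasNoTypeIVFactor A) (hA : HodgeConjectureFor A.dim A.X) : HodgeConjectureFor (A.prod C).dim (A.prod C).X :=
  (hodgeConjectureFor_prod_iff_of_hasNoTypeIVFactor_of_isOfCMType A C hA4 hCcm).2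
    ⟨hA, hodgeConjectureFor_of_dim_le_three_holds (by omega) isSmoothProjective_holds⟩

/-- **`HC(F × C) ⟸ HC(F)` for `F` SIMPLE of dimension `≥ 2` and `C` an elliptic curve, unless `C` is of CM type and `F` has a
factor of type IV** (`Hom(F, C) = 0` by simplicity; `C` not of CM type has `End⁰(C) = ℚ`,
`finrank_endAlgebra_eq_one_of_curve_of_not_isOfCMType`). [cite: MoonenZarhin1999LowDim, §3 Thm. (3.2)(2) and Lemma (3.4)]
[cite: MumfordAV1970, §19 Cor. 2 of Thm. 1 (p. 174)] -/
theorem hodgeConjectureFor_simple_prod_curve_of_hodgeConjectureFor (hFs : F.IsSimple) (hF2 : 2 ≤ F.dim) (hC : C.dim = 1)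
    (h : ¬ IsOfCMType C ∨ HasNoTypeIVFactor F) (hF : HodgeConjectureFor F.dim F.X) :
    HodgeConjectureFor (F.prod C).dim (F.prod C).X := by
  by_cases hCcm : IsOfCMType C
  · exact hodgeConjectureFor_prod_cmCurve_of_hasNoTypeIVFactor_of_hodgeConjectureFor hC hCcm (h.resolve_left (· hCcm)) hF
  · exact hodgeConjectureFor_prod_curve_of_finrank_eq_one_of_hodgeConjectureFor hC
      (finrank_endAlgebra_eq_one_of_curve_of_not_isOfCMType hC hCcm) (hom_eq_zero_of_isSimple_of_lt_dim hFs (by omega)) hF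

/-! ### §2 Fivefolds with a simple fourfold isogeny factor -/

/-- **If `X ∼ F × C` with `F` a simple fourfold and `C` a curve, then a CM elliptic isogeny factor of `X` forces `C` to be of
CM type** (`C' ≼ F × C` with `Hom(C', F) = 0` gives `C' ≼ C`, hence `C ∼ C'`). [cite: MumfordAV1970, §19 Thm. 1 and Cor. 1–2 (pp. 173–174)]
[cite: Milne1999, §2 p. 54] -/
theorem isOfCMType_curve_of_avDominatedBy_cmCurve {C' : AbelianVariety ℂ} (hFs : F.IsSimple) (hF2 : 2 ≤ F.dim)
    (hC : C.dim = 1) (hFC : AbelianVariety.IsIsogenous (F.prod C) X) (hC' : C'.dim = 1) (hC'cm : IsOfCMType C')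
    (hC'X : AVDominatedBy C' X) : IsOfCMType C := by
  obtain ⟨g, hg⟩ := hFC
  have hC'FC : AVDominatedBy C' (F.prod C) := hC'X.trans_isIsogeny_inv hg
  have hC'C : AVDominatedBy C' C :=
    avDominatedBy_right_of_forall_hom_eq_zero hC'FC (hom_eq_zero_of_isSimple_of_dim_lt hFs (by omega))
  have hCC' : AbelianVariety.IsIsogenous C C' :=
    isIsogenous_of_avDominatedBy_of_isSimple_of_dim_eq hC'C (isSimple_of_dim_le_one hC'.le) (by omega) (by omega)
  exact isOfCMType_of_avDominatedBy hC'cm (AVDominatedBy.of_isIsogenous hCC' (AVDominatedBy.refl C'))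

/-- **A fivefold `X` with a SIMPLE FOURFOLD isogeny factor `F` satisfying the Hodge conjecture satisfies the Hodge conjecture,
unless `X` has an elliptic isogeny factor of CM type and `F` has a factor of type IV** (`X ∼ F × C`, §1).
[cite: MoonenZarhin1999LowDim, Thm. 0.2 (3)–(4) and §3 Thm. (3.2)(2), Lemma (3.4)] [cite: MumfordAV1970, §19 Thm. 1 (pp. 173–174)] -/
theorem hodgeConjectureFor_of_avDominatedBy_simpleFourfold_of_hodgeConjectureFor (hX5 : X.dim = 5) (hFs : F.IsSimple)
    (hF4 : F.dim = 4) (hFX : AVDominatedBy F X) (hF : HodgeConjectureFor F.dim F.X)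
    (h : (∀ C' : AbelianVariety ℂ, C'.dim = 1 → IsOfCMType C' → ¬ AVDominatedBy C' X) ∨ HasNoTypeIVFactor F) :
    HodgeConjectureFor X.dim X.X := by
  obtain ⟨C, hdim, hFC⟩ := exists_prod_isIsogenous_of_avDominatedBy hFX
  have hC : C.dim = 1 := by omega
  refine HodgeConjectureFor.of_isIsogenous hFC.symm'
    (hodgeConjectureFor_simple_prod_curve_of_hodgeConjectureFor hFs (by omega) hC ?_ hF)
  rcases h with h | h
  · refine Or.inl fun hCcm => h C hC hCcm ?_
    obtain ⟨g, hg⟩ := hFC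
    exact (avDominatedBy_prod_right F C).trans_isIsogeny_hom hg
  · exact Or.inr h

/-- **THE FIVEFOLD CENSUS GRANTED MARKMAN AND THE ROW-`4` CELL.** Hypotheses: `hMark`; `hH1 : HC(simple fourfolds not of CM
type)` (the residual cell of row `4`, a class TARGET taken as hypothesis); for the fivefold `X`: (i) simple ⟹ of CM type
[Tankeev–Ribet]; (ii) NOT «`X ∼ C × F` with `C` an elliptic curve of CM type and `F` a simple fourfold not of CM type with a
factor of type IV» [case (g) and its sibling in Thm. 0.2 (3)–(4)]; (iii) NOT «`X ∼ E² × T`, `dim_ℚ End⁰(T) = 2`» [Thm. 0.2 (1)].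
Then HC holds for `X`. [cite: MoonenZarhin1999LowDim, Thm. 0.2] [claim: Markman2025SurveySecant, status: under-review] -/
theorem hodgeConjectureFor_of_dim_eq_five_of_markman_of_simpleFourfolds
    (hMark : Markman2025_weilClasses_algebraic_abelianFourfold)
    (hH1 : HCOnClass fun A => A.dim = 4 ∧ A.IsSimple ∧ ¬ IsOfCMType A) (hX5 : X.dim = 5)
    (hs : X.IsSimple → IsOfCMType X)
    (hg : ¬ ∃ C F : AbelianVariety ℂ, C.dim = 1 ∧ IsOfCMType C ∧ F.IsSimple ∧ F.dim = 4 ∧ ¬ IsOfCMType F ∧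
      ¬ HasNoTypeIVFactor F ∧ AbelianVariety.IsIsogenous X (C.prod F))
    (hne : ¬ ∃ E T : AbelianVariety ℂ, E.dim = 1 ∧ IsOfCMType E ∧ T.IsSimple ∧ T.dim = 3 ∧
      Module.finrank ℚ T.endAlgebra = 2 ∧ Nonempty (E.endAlgebra →+* T.endAlgebra) ∧
      AbelianVariety.IsIsogenous X (E.prod (E.prod T))) :
    HodgeConjectureFor X.dim X.X := by
  by_cases hF : ∃ F : AbelianVariety ℂ, F.IsSimple ∧ F.dim = 4 ∧ ¬ IsOfCMType F ∧ AVDominatedBy F X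
  · -- a simple non-CM fourfold factor: `X ∼ F × C`, `HC(F)` from `hH1`, split unless the excluded cell
    obtain ⟨F, hFs, hF4, hFcm, hFX⟩ := hF
    obtain ⟨C, hdim, hFC⟩ := exists_prod_isIsogenous_of_avDominatedBy hFX
    have hC : C.dim = 1 := by omega
    have hsplit : ¬ IsOfCMType C ∨ HasNoTypeIVFactor F := by
      by_contra hns
      push Not at hns
      exact hg ⟨C, F, hC, hns.1, hFs, hF4, hFcm, hns.2, hFC.symm'.trans (isIsogenous_prod_comm F C)⟩
    exact HodgeConjectureFor.of_isIsogenous hFC.symm'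
      (hodgeConjectureFor_simple_prod_curve_of_hodgeConjectureFor hFs (by omega) hC hsplit (hH1 F ⟨hF4, hFs, hFcm⟩))
  · push Not at hF
    exact hodgeConjectureFor_of_dim_eq_five_of_markman hMark hX5 hs
      (fun F hFs hF4 hFX => by_contra fun hFcm => hF F hFs hF4 hFcm hFX) hne

/-! ### §3 The axis: row `5` and `HCUpToDim 5` modulo Markman, with the row-`4` cell factored out -/

/-- **Row `5` modulo Markman and the row-`4` cell**: granted `hMark` and `HC(simple non-CM fourfolds)`,
`HCAtDim 5 ↔ HC(𝒞₅″)` with `𝒞₅″` = simple non-CM fivefolds ∪ «`C × F`, `C` a CM elliptic curve, `F` a simple non-CM fourfold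
with a type-IV factor» ∪ «`E² × T`, `dim_ℚ End⁰(T) = 2`». [cite: MoonenZarhin1999LowDim, Thm. 0.2]
[claim: Markman2025SurveySecant, status: under-review] -/
theorem hcAtDim_five_iff_of_markman_of_simpleFourfolds (hMark : Markman2025_weilClasses_algebraic_abelianFourfold)
    (hH1 : HCOnClass fun A => A.dim = 4 ∧ A.IsSimple ∧ ¬ IsOfCMType A) :
    HCAtDim 5 ↔ HCOnClass fun A => A.dim = 5 ∧ ((A.IsSimple ∧ ¬ IsOfCMType A) ∨
      (∃ C F : AbelianVariety ℂ, C.dim = 1 ∧ IsOfCMType C ∧ F.IsSimple ∧ F.dim = 4 ∧ ¬ IsOfCMType F ∧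
        ¬ HasNoTypeIVFactor F ∧ AbelianVariety.IsIsogenous A (C.prod F)) ∨
      (∃ E T : AbelianVariety ℂ, E.dim = 1 ∧ IsOfCMType E ∧ T.IsSimple ∧ T.dim = 3 ∧
        Module.finrank ℚ T.endAlgebra = 2 ∧ Nonempty (E.endAlgebra →+* T.endAlgebra) ∧
        AbelianVariety.IsIsogenous A (E.prod (E.prod T)))) := by
  refine ⟨fun h => hcOnClass_mono (fun A hA => hA.1) h, fun h A hA5 => ?_⟩
  by_cases h1 : A.IsSimple ∧ ¬ IsOfCMType A
  · exact h A ⟨hA5, Or.inl h1⟩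
  by_cases h2 : ∃ C F : AbelianVariety ℂ, C.dim = 1 ∧ IsOfCMType C ∧ F.IsSimple ∧ F.dim = 4 ∧ ¬ IsOfCMType F ∧
      ¬ HasNoTypeIVFactor F ∧ AbelianVariety.IsIsogenous A (C.prod F)
  · exact h A ⟨hA5, Or.inr (Or.inl h2)⟩
  by_cases h3 : ∃ E T : AbelianVariety ℂ, E.dim = 1 ∧ IsOfCMType E ∧ T.IsSimple ∧ T.dim = 3 ∧
      Module.finrank ℚ T.endAlgebra = 2 ∧ Nonempty (E.endAlgebra →+* T.endAlgebra) ∧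
      AbelianVariety.IsIsogenous A (E.prod (E.prod T))
  · exact h A ⟨hA5, Or.inr (Or.inr h3)⟩
  exact hodgeConjectureFor_of_dim_eq_five_of_markman_of_simpleFourfolds hMark hH1 hA5
    (fun hs => by_contra fun hcm => h1 ⟨hs, hcm⟩) h2 h3

/-- **`HCUpToDim 5` modulo Markman, refined**: `HCUpToDim 5 ↔ HC(simple non-CM fourfolds) ∧ HC(𝒞₅″)` — compared with
`hcUpToDim_five_iff_of_markman` (R35-C) the cell «a simple non-CM fourfold factor» is replaced by its sub-cell «CM elliptic
curve × simple non-CM fourfold with a type-IV factor», the rest of it being implied by the row-`4` cell.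
[cite: MoonenZarhin1999LowDim, Thm. 0.1 and Thm. 0.2] [claim: Markman2025SurveySecant, status: under-review] -/
theorem hcUpToDim_five_iff_of_markman' (hMark : Markman2025_weilClasses_algebraic_abelianFourfold) :
    HCUpToDim 5 ↔ (HCOnClass fun A => A.dim = 4 ∧ A.IsSimple ∧ ¬ IsOfCMType A) ∧
      HCOnClass fun A => A.dim = 5 ∧ ((A.IsSimple ∧ ¬ IsOfCMType A) ∨
        (∃ C F : AbelianVariety ℂ, C.dim = 1 ∧ IsOfCMType C ∧ F.IsSimple ∧ F.dim = 4 ∧ ¬ IsOfCMType F ∧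
          ¬ HasNoTypeIVFactor F ∧ AbelianVariety.IsIsogenous A (C.prod F)) ∨
        (∃ E T : AbelianVariety ℂ, E.dim = 1 ∧ IsOfCMType E ∧ T.IsSimple ∧ T.dim = 3 ∧
          Module.finrank ℚ T.endAlgebra = 2 ∧ Nonempty (E.endAlgebra →+* T.endAlgebra) ∧
          AbelianVariety.IsIsogenous A (E.prod (E.prod T)))) := by
  rw [hcUpToDim_succ_iff 4, hcUpToDim_succ_iff 3, hcAtDim_four_iff_simple_nonCM_of_markman hMark]
  constructor
  · rintro ⟨⟨-, h4⟩, h5⟩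
    exact ⟨h4, (hcAtDim_five_iff_of_markman_of_simpleFourfolds hMark h4).1 h5⟩
  · rintro ⟨h4, h5⟩
    exact ⟨⟨hcUpToDim_three, h4⟩, (hcAtDim_five_iff_of_markman_of_simpleFourfolds hMark h4).2 h5⟩

/-- **… and granted Tankeev–Ribet as well**: `HCUpToDim 5 ↔ HC(simple non-CM fourfolds) ∧ HC(«CM curve × simple non-CM
fourfold with a type-IV factor» ∪ «E² × T, dim_ℚ End⁰(T) = 2»)` — modulo `hMark` and Tankeev–Ribet, the Hodge conjecture in
dimension `≤ 5` is EXACTLY Moonen–Zarhin 1995 (simple fourfolds) + case (g) with its `(2,2)` sibling + Thm. 0.2 (1).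
[cite: MoonenZarhin1999LowDim, Thm. 0.1, Thm. 0.2 and §2 Thm. (2.7)] [claim: Markman2025SurveySecant, status: under-review] -/
theorem hcUpToDim_five_iff_of_markman_of_tankeevRibet' (hMark : Markman2025_weilClasses_algebraic_abelianFourfold)
    (hTR : TankeevRibet1983_hodgeClasses_divisorial_powers_simplePrimeDimension) :
    HCUpToDim 5 ↔ (HCOnClass fun A => A.dim = 4 ∧ A.IsSimple ∧ ¬ IsOfCMType A) ∧
      HCOnClass fun A => A.dim = 5 ∧
        ((∃ C F : AbelianVariety ℂ, C.dim = 1 ∧ IsOfCMType C ∧ F.IsSimple ∧ F.dim = 4 ∧ ¬ IsOfCMType F ∧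
          ¬ HasNoTypeIVFactor F ∧ AbelianVariety.IsIsogenous A (C.prod F)) ∨
        (∃ E T : AbelianVariety ℂ, E.dim = 1 ∧ IsOfCMType E ∧ T.IsSimple ∧ T.dim = 3 ∧
          Module.finrank ℚ T.endAlgebra = 2 ∧ Nonempty (E.endAlgebra →+* T.endAlgebra) ∧
          AbelianVariety.IsIsogenous A (E.prod (E.prod T)))) := by
  rw [hcUpToDim_five_iff_of_markman' hMark]
  refine and_congr_right fun _ => ⟨fun h => hcOnClass_mono (fun A hA => ⟨hA.1, Or.inr hA.2⟩) h, fun h A hA => ?_⟩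
  rcases hA.2 with hs | hrest
  · exact hcOnClass_simple_primeDim_of_tankeevRibet hTR A ⟨hs.1, by rw [hA.1]; norm_num⟩
  · exact h A ⟨hA.1, hrest⟩

/-- **On path**: every cell of this file is a case of the summit. [cite: Deligne2000, §1] -/
theorem refinedResidualCells_of_hodgeConjecture (h : _root_.HodgeConjecture) :
    (HCOnClass fun A => A.dim = 4 ∧ A.IsSimple ∧ ¬ IsOfCMType A) ∧
      HCOnClass fun A => A.dim = 5 ∧ ((A.IsSimple ∧ ¬ IsOfCMType A) ∨
        (∃ C F : AbelianVariety ℂ, C.dim = 1 ∧ IsOfCMType C ∧ F.IsSimple ∧ F.dim = 4 ∧ ¬ IsOfCMType F ∧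
          ¬ HasNoTypeIVFactor F ∧ AbelianVariety.IsIsogenous A (C.prod F)) ∨
        (∃ E T : AbelianVariety ℂ, E.dim = 1 ∧ IsOfCMType E ∧ T.IsSimple ∧ T.dim = 3 ∧
          Module.finrank ℚ T.endAlgebra = 2 ∧ Nonempty (E.endAlgebra →+* T.endAlgebra) ∧
          AbelianVariety.IsIsogenous A (E.prod (E.prod T)))) :=
  ⟨hcOnClass_of_hodgeConjecture _ h, hcOnClass_of_hodgeConjecture _ h⟩

end Summit.HodgeConjecture.Ring2.LowDimOfMarkman

end
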